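import Mathlib

/-!
# Stub `HConst` (crux `HiddenCornerLemmaR`, stmt-MatrixMultiplication-10752, line `Sketch`)

The H-constant compression class of the hidden-corner lemma.  Let `Z` be the lower shift on
`ℂ^N` (`Z i j = [i = j + 1]`).  Suppose every coefficient matrix `T a b` of a pencil satisfies the
Stein displacement equation `T a b − Z (T a b) Zᵀ = G a b * H₀ᵀ` with ONE constant right factor
`H₀ : N × d`, and the pencil hides a linearly explained corner `(∑ X a b • T a b) * E = F * X`
with `F ≠ 0`.  Then `r ≤ d` (no rank or nonsingularity hypotheses).

Proof (formalised below).
* Stein telescoping: `T = ∑_{k<N} Z^k D (Zᵀ)^k + Z^N T (Zᵀ)^N` with `D = G a b * H₀ᵀ`.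
* Corner per coefficient: `X := Matrix.single a b 1` gives `T a b * E = F * single a b 1`.
* Pass to polynomials: a column `v ∈ ℂ^N` becomes `vp v = ∑ C (v l) X^l ∈ ℂ[X]`; then
  `vp (Z * A) ≡ X * vp A (mod X^N)` and `vp (A * S) = ∑ vp (A · a) * C (S a c)`.  Hence, for a
  fixed `a`, with `Γ b j = vp (col j of G a b)` (`r × d`) and
  `Ψ j c = ∑_k X^k C ((H₀ᵀ (Zᵀ)^k E) j c)` (`d × r`), one gets `Γ * Ψ ≡ φ • 1 (mod X^N)` where
  `φ = vp (col a of F)`.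
* Choose `a` with `φ ≠ 0`, write `φ = X^m u`, `u(0) ≠ 0`, `m < N`.  Then
  `Γ * Ψ = X^m • (u • 1 + X^{N-m} • Y)` has determinant `X^{m r} · q` with `q(0) = u(0)^r ≠ 0`,
  while `det (Γ * Ψ) = 0` if `d < r` (evaluate at every `z : ℂ`: an `r × d` times `d × r`
  product has rank `≤ d < r`).  Contradiction, so `r ≤ d`.
-/

set_option linter.dupNamespace false

namespace Summit.MatrixMultiplication.MatrixMultiplication.Theorems

open Polynomial Matrix

/-- Coefficient extraction: the `i`-th coefficient of `∑ C (A l c) X^l` is `A i c`. -/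
private theorem hconst_coeff_vp {N n : ℕ} (A : Matrix (Fin N) (Fin n) ℂ) (c : Fin n) (i : Fin N) :
    (∑ l : Fin N, C (A l c) * X ^ (l : ℕ)).coeff i = A i c := by
  simp [finsetSum_coeff, Fin.val_inj]

/-- The coefficients of `∑ C (A l c) X^l` vanish from degree `N` on. -/
private theorem hconst_coeff_vp_of_le {N n : ℕ} (A : Matrix (Fin N) (Fin n) ℂ) (c : Fin n)
    {m : ℕ} (hm : N ≤ m) : (∑ l : Fin N, C (A l c) * X ^ (l : ℕ)).coeff m = 0 := by
  simp only [finsetSum_coeff, coeff_C_mul_X_pow]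
  refine Finset.sum_eq_zero fun l _ => ?_
  rw [if_neg]
  have := l.is_lt
  omega

/-- Product rule: the column polynomial of `A * S` is a `C`-linear combination of those of `A`. -/
private theorem hconst_vp_mul {N n n' : ℕ} (A : Matrix (Fin N) (Fin n) ℂ)
    (S : Matrix (Fin n) (Fin n') ℂ) (c : Fin n') :
    (∑ l : Fin N, C ((A * S) l c) * X ^ (l : ℕ)) =
      ∑ a : Fin n, (∑ l : Fin N, C (A l a) * X ^ (l : ℕ)) * C (S a c) := by
  simp only [Matrix.mul_apply, map_sum, map_mul, Finset.sum_mul]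
  rw [Finset.sum_comm]
  refine Finset.sum_congr rfl fun a _ => Finset.sum_congr rfl fun l _ => ?_
  ring

/-- Entries of `Z * A` for the lower shift `Z`: row `i` of `Z * A` is row `i - 1` of `A`
(and row `0` vanishes). -/
private theorem hconst_shift_mul_apply {N n : ℕ} (Z : Matrix (Fin N) (Fin N) ℂ)
    (hZ : ∀ i j, Z i j = if (i : ℕ) = (j : ℕ) + 1 then 1 else 0)
    (A : Matrix (Fin N) (Fin n) ℂ) (i : Fin N) (c : Fin n) :
    (Z * A) i c = if h : 0 < (i : ℕ) then A ⟨(i : ℕ) - 1, by omega⟩ c else 0 := by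
  rw [Matrix.mul_apply]
  split_ifs with h
  · rw [Finset.sum_eq_single ⟨(i : ℕ) - 1, by omega⟩]
    · rw [hZ, if_pos (by simp; omega), one_mul]
    · intro l _ hl
      rw [hZ, if_neg, zero_mul]
      intro h'
      apply hl
      ext
      simp
      omega
    · intro h'; exact absurd (Finset.mem_univ _) h'
  · refine Finset.sum_eq_zero fun l _ => ?_
    rw [hZ, if_neg (by omega), zero_mul]

/-- Multiplication by the shift is multiplication by `X` modulo `X ^ N`:
`vp (Z * A) ≡ X * vp A (mod X^N)`. -/
private theorem hconst_vp_shift_mul {N n : ℕ} (Z : Matrix (Fin N) (Fin N) ℂ)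
    (hZ : ∀ i j, Z i j = if (i : ℕ) = (j : ℕ) + 1 then 1 else 0)
    (A : Matrix (Fin N) (Fin n) ℂ) (c : Fin n) :
    (X : ℂ[X]) ^ N ∣ (∑ l : Fin N, C ((Z * A) l c) * X ^ (l : ℕ)) -
      X * (∑ l : Fin N, C (A l c) * X ^ (l : ℕ)) := by
  rw [X_pow_dvd_iff]
  intro m hm
  rw [coeff_sub, sub_eq_zero]
  have h1 := hconst_coeff_vp (Z * A) c ⟨m, hm⟩
  simp only at h1
  rw [h1, hconst_shift_mul_apply Z hZ A]
  rcases m with _ | m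
  · simp
  · rw [coeff_X_mul, dif_pos (by simp)]
    have h2 := hconst_coeff_vp A c ⟨m, by omega⟩
    simp only at h2
    rw [h2]
    rfl

/-- Iterate: `vp (Z ^ k * A) ≡ X ^ k * vp A (mod X^N)`. -/
private theorem hconst_vp_shift_pow_mul {N n : ℕ} (Z : Matrix (Fin N) (Fin N) ℂ)
    (hZ : ∀ i j, Z i j = if (i : ℕ) = (j : ℕ) + 1 then 1 else 0)
    (A : Matrix (Fin N) (Fin n) ℂ) (c : Fin n) (k : ℕ) :
    (X : ℂ[X]) ^ N ∣ (∑ l : Fin N, C ((Z ^ k * A) l c) * X ^ (l : ℕ)) -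
      X ^ k * (∑ l : Fin N, C (A l c) * X ^ (l : ℕ)) := by
  induction k with
  | zero => simp
  | succ k ih =>
    have h1 := hconst_vp_shift_mul Z hZ (Z ^ k * A) c
    have h2 := (ih.mul_left X).add h1
    rw [pow_succ', Matrix.mul_assoc]
    convert h2 using 1
    ring

/-- Stein telescoping: if `M - Z M Zᵀ = D` then `M = ∑_{k<n} Z^k D (Zᵀ)^k + Z^n M (Zᵀ)^n`. -/
private theorem hconst_stein_telescope {N : ℕ} (Z M D : Matrix (Fin N) (Fin N) ℂ)
    (h : M - Z * M * Zᵀ = D) (n : ℕ) :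
    M = (∑ k ∈ Finset.range n, Z ^ k * D * Zᵀ ^ k) + Z ^ n * M * Zᵀ ^ n := by
  induction n with
  | zero => simp
  | succ n ih =>
    have hM : M = D + Z * M * Zᵀ := by rw [← h]; abel
    have step : Z ^ n * M * Zᵀ ^ n =
        Z ^ n * D * Zᵀ ^ n + Z ^ (n + 1) * M * Zᵀ ^ (n + 1) := by
      conv_lhs => rw [hM]
      rw [pow_succ, pow_succ']
      simp only [Matrix.mul_add, Matrix.add_mul, Matrix.mul_assoc]
    rw [Finset.sum_range_succ, add_assoc, ← step]
    exact ih

/-- Corner per coefficient: testing the corner identity on `X = single a b 1` gives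
`T a b * E = F * single a b 1`. -/
private theorem hconst_corner_single {r N : ℕ} (T : Fin r → Fin r → Matrix (Fin N) (Fin N) ℂ)
    (E F : Matrix (Fin N) (Fin r) ℂ)
    (hcorner : ∀ X : Matrix (Fin r) (Fin r) ℂ,
      (∑ a : Fin r, ∑ b : Fin r, X a b • T a b) * E = F * X)
    (a b : Fin r) :
    T a b * E = F * Matrix.single a b (1 : ℂ) := by
  have h := hcorner (Matrix.single a b 1)
  have hs : (∑ a' : Fin r, ∑ b' : Fin r, Matrix.single a b (1 : ℂ) a' b' • T a' b') = T a b := by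
    simp [Matrix.single_apply, ite_and, ite_smul, Finset.sum_ite_eq]
  rw [hs] at h
  exact h

/-- Over `ℂ[X]`, an `r × d` by `d × r` product with `d < r` has zero determinant
(evaluate at every point of the infinite field `ℂ`; the evaluated product has rank `≤ d < r`). -/
private theorem hconst_det_mul_eq_zero_of_lt {r d : ℕ} (hdr : d < r)
    (Γ : Matrix (Fin r) (Fin d) ℂ[X]) (Ψ : Matrix (Fin d) (Fin r) ℂ[X]) : (Γ * Ψ).det = 0 := by
  refine Polynomial.funext fun z => ?_
  rw [eval_zero, ← coe_evalRingHom, RingHom.map_det, RingHom.mapMatrix_apply, Matrix.map_mul]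
  by_contra hne
  have hU : IsUnit (Γ.map (evalRingHom z) * Ψ.map (evalRingHom z)) :=
    (Matrix.isUnit_iff_isUnit_det _).mpr (isUnit_iff_ne_zero.mpr hne)
  have h1 := Matrix.rank_of_isUnit _ hU
  have h2 := (Matrix.rank_mul_le_left (Γ.map (evalRingHom z)) (Ψ.map (evalRingHom z))).trans
    (Matrix.rank_le_width _)
  rw [Fintype.card_fin] at h1
  omega

/-- Key congruence.  For fixed `a b c`, modulo `X ^ N`,
`∑ j vp(col j of G a b) * Ψ j c ≡ [b = c] · vp(col a of F)`, where
`Ψ j c = ∑_{k<N} X^k C ((H₀ᵀ (Zᵀ)^k E) j c)`. -/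
private theorem hconst_key_congr {r N d : ℕ} (Z : Matrix (Fin N) (Fin N) ℂ)
    (hZ : ∀ i j, Z i j = if (i : ℕ) = (j : ℕ) + 1 then 1 else 0)
    (T : Fin r → Fin r → Matrix (Fin N) (Fin N) ℂ) (E F : Matrix (Fin N) (Fin r) ℂ)
    (H₀ : Matrix (Fin N) (Fin d) ℂ) (G : Fin r → Fin r → Matrix (Fin N) (Fin d) ℂ)
    (hcorner : ∀ X : Matrix (Fin r) (Fin r) ℂ,
      (∑ a : Fin r, ∑ b : Fin r, X a b • T a b) * E = F * X)
    (hdisp : ∀ a b, T a b - Z * T a b * Zᵀ = G a b * H₀ᵀ) (a b c : Fin r) :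
    (X : ℂ[X]) ^ N ∣ (∑ j : Fin d, (∑ l : Fin N, C (G a b l j) * X ^ (l : ℕ)) *
        (∑ k ∈ Finset.range N, X ^ k * C ((H₀ᵀ * Zᵀ ^ k * E) j c))) -
      (if b = c then ∑ l : Fin N, C (F l a) * X ^ (l : ℕ) else 0) := by
  rw [← Ideal.mem_span_singleton, ← Ideal.Quotient.eq]
  set π := Ideal.Quotient.mk (Ideal.span {(X : ℂ[X]) ^ N}) with hπdef
  have hπk : ∀ {n : ℕ} (A : Matrix (Fin N) (Fin n) ℂ) (c : Fin n) (k : ℕ),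
      π (∑ l : Fin N, C ((Z ^ k * A) l c) * X ^ (l : ℕ)) =
        π (X ^ k * ∑ l : Fin N, C (A l c) * X ^ (l : ℕ)) := by
    intro n A c k
    rw [Ideal.Quotient.eq, Ideal.mem_span_singleton]
    exact hconst_vp_shift_pow_mul Z hZ A c k
  have hπN : π (X ^ N) = 0 :=
    Ideal.Quotient.eq_zero_iff_mem.mpr (Ideal.mem_span_singleton_self _)
  have hTE : T a b * E = (∑ k ∈ Finset.range N, Z ^ k * (G a b * (H₀ᵀ * Zᵀ ^ k * E))) +
      Z ^ N * (T a b * Zᵀ ^ N * E) := by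
    conv_lhs => rw [hconst_stein_telescope Z (T a b) (G a b * H₀ᵀ) (hdisp a b) N]
    simp only [Matrix.add_mul, Matrix.sum_mul, Matrix.mul_assoc]
  have h1 : (∑ l : Fin N, C ((T a b * E) l c) * X ^ (l : ℕ)) =
      if b = c then ∑ l : Fin N, C (F l a) * X ^ (l : ℕ) else 0 := by
    rw [hconst_corner_single T E F hcorner a b, hconst_vp_mul]
    simp only [Matrix.single_apply]
    rw [Finset.sum_eq_single a]
    · by_cases hbc : b = c <;> simp [hbc]
    · intro a' _ ha'
      simp [Ne.symm ha']
    · intro h; exact absurd (Finset.mem_univ a) h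
  have h2 : (∑ l : Fin N, C ((T a b * E) l c) * X ^ (l : ℕ)) =
      (∑ k ∈ Finset.range N, ∑ l : Fin N,
        C ((Z ^ k * (G a b * (H₀ᵀ * Zᵀ ^ k * E))) l c) * X ^ (l : ℕ)) +
      ∑ l : Fin N, C ((Z ^ N * (T a b * Zᵀ ^ N * E)) l c) * X ^ (l : ℕ) := by
    rw [hTE]
    simp only [Matrix.add_apply, Matrix.sum_apply, map_add, map_sum, add_mul, Finset.sum_mul,
      Finset.sum_add_distrib]
    congr 1
    exact Finset.sum_comm
  have h3 : (∑ j : Fin d, (∑ l : Fin N, C (G a b l j) * X ^ (l : ℕ)) *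
        (∑ k ∈ Finset.range N, X ^ k * C ((H₀ᵀ * Zᵀ ^ k * E) j c))) =
      ∑ k ∈ Finset.range N, X ^ k *
        ∑ l : Fin N, C ((G a b * (H₀ᵀ * Zᵀ ^ k * E)) l c) * X ^ (l : ℕ) := by
    simp_rw [hconst_vp_mul]
    simp only [Finset.mul_sum]
    rw [Finset.sum_comm]
    refine Finset.sum_congr rfl fun k _ => Finset.sum_congr rfl fun j _ => ?_
    ring
  rw [← h1, h2, h3, map_add, map_sum, map_sum, hπk _ _ N, map_mul, hπN, zero_mul, add_zero]
  exact Finset.sum_congr rfl fun k _ => (hπk _ _ k).symm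

/-- H-const lemma. If every coefficient matrix `T a b` of the pencil has Stein displacement
`T a b − Z (T a b) Zᵀ = G a b * H₀ᵀ` with the SAME constant right factor `H₀ : N × d`, and the pencil
hides a linearly explained corner `(Σ X a b • T a b) E = F X` with `F ≠ 0`, then `r ≤ d`.
No rank hypothesis on `E`, `F` and no nonsingularity is needed. -/
theorem hclR_hconst_bound (r N d : ℕ) (T : Fin r → Fin r → Matrix (Fin N) (Fin N) ℂ)
    (E F : Matrix (Fin N) (Fin r) ℂ) (H₀ : Matrix (Fin N) (Fin d) ℂ)
    (G : Fin r → Fin r → Matrix (Fin N) (Fin d) ℂ)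
    (hF : F ≠ 0)
    (hcorner : ∀ X : Matrix (Fin r) (Fin r) ℂ, (∑ a : Fin r, ∑ b : Fin r, X a b • T a b) * E = F * X)
    (hdisp : ∀ a b, T a b - (Matrix.of fun i j : Fin N => if (i : ℕ) = (j : ℕ) + 1 then (1 : ℂ) else 0) * T a b *
        (Matrix.of fun i j : Fin N => if (i : ℕ) = (j : ℕ) + 1 then (1 : ℂ) else 0)ᵀ = G a b * H₀ᵀ) :
    r ≤ d := by
  set Z : Matrix (Fin N) (Fin N) ℂ :=
    Matrix.of fun i j : Fin N => if (i : ℕ) = (j : ℕ) + 1 then (1 : ℂ) else 0 with hZdef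
  have hZ : ∀ i j, Z i j = if (i : ℕ) = (j : ℕ) + 1 then (1 : ℂ) else 0 := fun i j => rfl
  by_contra hlt
  push Not at hlt
  -- a nonzero entry of `F`
  obtain ⟨i₀, a, ha⟩ : ∃ i a, F i a ≠ 0 := by
    by_contra h
    push Not at h
    exact hF (Matrix.ext fun i j => by simpa using h i j)
  -- polynomial data attached to the row index `a`
  set φ : ℂ[X] := ∑ l : Fin N, C (F l a) * X ^ (l : ℕ) with hφdef
  set Γ : Matrix (Fin r) (Fin d) ℂ[X] :=
    Matrix.of fun b j => ∑ l : Fin N, C (G a b l j) * X ^ (l : ℕ) with hΓdef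
  set Ψ : Matrix (Fin d) (Fin r) ℂ[X] :=
    Matrix.of fun j c => ∑ k ∈ Finset.range N, X ^ k * C ((H₀ᵀ * Zᵀ ^ k * E) j c) with hΨdef
  have hkey : ∀ b c, ∃ y : ℂ[X], (Γ * Ψ) b c - (if b = c then φ else 0) = X ^ N * y := by
    intro b c
    obtain ⟨y, hy⟩ := hconst_key_congr Z hZ T E F H₀ G hcorner hdisp a b c
    exact ⟨y, by rw [← hy, Matrix.mul_apply]; rfl⟩
  choose Y hY using hkey
  -- `φ ≠ 0` and its factorisation `φ = X ^ m * u` with `u.coeff 0 ≠ 0` and `m < N`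
  have hφ0 : φ ≠ 0 := by
    intro h
    apply ha
    have := hconst_coeff_vp F a i₀
    rw [← hφdef, h, coeff_zero] at this
    exact this.symm
  obtain ⟨u, hu, hXu⟩ := exists_eq_pow_rootMultiplicity_mul_and_not_dvd φ hφ0 0
  rw [map_zero, sub_zero] at hu hXu
  rw [X_dvd_iff] at hXu
  set m := rootMultiplicity 0 φ with hmdef
  have hmN : m < N := by
    by_contra hle
    push Not at hle
    apply hφ0
    ext n
    rw [coeff_zero]
    rcases lt_or_ge n N with hn | hn
    · have hdvd : (X : ℂ[X]) ^ N ∣ φ := (pow_dvd_pow X hle).trans ⟨u, hu⟩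
      exact (X_pow_dvd_iff.mp hdvd) n hn
    · exact hconst_coeff_vp_of_le F a hn
  have hXN : (X : ℂ[X]) ^ N = X ^ m * X ^ (N - m) := by
    rw [← pow_add, Nat.add_sub_cancel' hmN.le]
  -- factor the product matrix: `Γ * Ψ = X ^ m • (u • 1 + X ^ (N - m) • Y)`
  have hprod : Γ * Ψ = (X : ℂ[X]) ^ m •
      Matrix.of (fun b c => (if b = c then u else 0) + X ^ (N - m) * Y b c) := by
    ext b c
    have e := hY b c
    rw [sub_eq_iff_eq_add] at e
    rw [e, Matrix.smul_apply, Matrix.of_apply, smul_eq_mul, hXN]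
    split_ifs with hbc
    · rw [hu]; ring_nf
    · ring_nf
  -- determinants: `det (Γ * Ψ) = 0`, but the right-hand side has nonzero determinant
  have hdet := hconst_det_mul_eq_zero_of_lt hlt Γ Ψ
  rw [hprod, Matrix.det_smul, Fintype.card_fin, mul_eq_zero] at hdet
  rcases hdet with h | h
  · exact (pow_ne_zero _ (pow_ne_zero _ X_ne_zero)) h
  · have h' := congrArg (eval 0) h
    rw [eval_zero, ← coe_evalRingHom, RingHom.map_det, RingHom.mapMatrix_apply] at h'
    have hmap : (Matrix.of fun b c => (if b = c then u else 0) + X ^ (N - m) * Y b c).map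
        (evalRingHom 0) = Matrix.diagonal fun _ => eval 0 u := by
      ext b c
      simp only [Matrix.map_apply, Matrix.of_apply, coe_evalRingHom, eval_add, eval_mul, eval_pow,
        eval_X, Matrix.diagonal_apply]
      rw [zero_pow (Nat.sub_ne_zero_of_lt hmN), zero_mul, add_zero]
      split_ifs <;> simp
    rw [hmap, Matrix.det_diagonal, Finset.prod_const, Finset.card_univ, Fintype.card_fin] at h'
    apply hXu
    rw [coeff_zero_eq_eval_zero]
    exact (pow_eq_zero_iff (by omega)).mp h'

end Summit.MatrixMultiplication.MatrixMultiplication.Theorems
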